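import Summits.BirchSwinnertonDyer.BirchSwinnertonDyer.Theorems.SchneiderFreeAdditiveX3BranchIMCRebaseCovolume
import Summits.BirchSwinnertonDyer.Rank1Residual.AdditivePotMult.PStarTwistModel
import Summits.BirchSwinnertonDyer.Rank1Residual.AdditivePotMult.Twist
import Literature.Barriers.BirchSwinnertonDyer.ReducibleAnticyclotomicAtBadP
import HarnessLib

/-!
# Route `SchneiderFreeAdditiveX3` (K1 door), crux `PotMultBranchIMC` (stmt-BirchSwinnertonDyer-19176):
# the (M) cell's `p*`-partner is a class-X2 pair — placement of crux r2 behind the catalogued barrier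
# `ReducibleAnticyclotomicAtBadP`, and the rebased value road of crux r3 does NOT instantiate on (M)

Cell `bsd-schneider-ideate`, seat `bsd-schneider-door-c2` (prover, generation 6). HONEST FRAMING:
BSD is not advanced by this file; crux r2 `PotMultBranchIMC` (item 19176) stays OPEN. This is a
PLACEMENT record (D-0021) and a typed OBSTRUCTION, both kernel-checked, for the potentially
multiplicative cell (M) of the door (X3 ∧ (M), `r_an = 1`: 4 541 of the door's 7 101 pairs).

* §1 **Every `p*`-partner is an X2 pair.** On the door's (M) cell (`ClassX3 W p`, `Additive.SubM W p`,
  `p` odd, `W` globally minimal) every Weierstrass model `V/ℚ` with `C • V^{(p*)} = W` — the curve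
  whose newform `f̃ = f_V` (level `N_E / p`, `p ‖ N_V`) carries the Keller–Yin / Castella–Hsieh
  currency of the door (`f_E = f̃ ⊗ ε_{p*}`, branch character `χ_ε = ε_{p*} ∘ N_{K/ℚ}` of conductor
  `p`) — is a CLASS-X2 pair: `p ≠ 2 ∧ Red V p ∧ Mult V p` (`classX2_partner_of_subM`; the partner
  exists, `exists_classX2_partner_of_subM`).
* §2 **Placement behind the barrier.** Hence the catalogued scope wall
  `Literature.Barriers.BirchSwinnertonDyer.ReducibleAnticyclotomicAtBadP` (bsd-eis, 2026-08-26: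
  "no printed anticyclotomic Iwasawa theory at an Eisenstein prime of BAD reduction — every refereed
  input is printed under `p ∤ N` or under `E[p]` irreducible") applies BY NAME to the partner of
  every (M)-cell pair: `¬ PrintedEisensteinAnticyclotomicScope V p`
  (`not_printedScope_partner_of_subM`). Reading for the route's BARRIERS section (which cites
  `HeegnerPointBarrier*`, `AnticyclotomicHeightDegeneracy*`, `PAdicHeightNondegeneracy` but not this
  entry): crux r2 sits INSIDE the technique class of `ReducibleAnticyclotomicAtBadP` at the partner
  pair `(V, p)`, one step further in (the `χ_ε`-BRANCH of conductor `p`, not the trivial branch);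
  the entry's evasion (i) "Hida limit" (Keller–Yin arXiv:2402.12781 Thm. D, PREPRINT, trivial
  branch) moved to the `χ_ε`-branch is exactly this seat's gen-2 template W1–W3 (unwritten).
* §3 **The rebased value road does not instantiate on (M).** Door-c3's rebased road for crux r3
  (`additiveIMCLowerBDPOnTreeLeAt_of_valueAt_twisted_of_genusDatum'`, (G-ord, `e = 2`) cell, partner
  GOOD at `p`) carries Cai–Shu–Tian's Heegner condition `HeegnerConditionRC W′ K p …` for the
  partner at conductor `c = p`, whose first clause is `(c, N_{W′}) = 1` (ANT 8 (2014) p. 2524,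
  condition (1)). On (M) the partner is multiplicative at `p`, so `p ∣ N_V` and the clause FAILS:
  `¬ HeegnerConditionRC V K p ϕ χ` for every `K`, `ϕ`, `χ` (`not_heegnerConditionRC_of_mult`,
  `not_heegnerConditionRC_partner_of_subM`). So the (M) twin of the rebased road is VACUOUS as
  typed; the printed Gross–Zagier input at joint ramification is Cai–Shu–Tian's GENERAL Thm. 1.5
  (`Σ ∋ p`: "if `v ‖ N` then `ord_v(c/N) ≥ 0`", arXiv:1408.1733 p. 6), on the Shimura curve of an
  admissible order — untyped — and on (M) it is not needed by the door: the socket's value clause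
  is stated at the door's OWN conductor-1 Heegner point `P ∈ E(K)` on `X₀(N_E)`, for which the
  tree's `gross_zagier` is the printed Gross–Zagier input (`L(f̃, χ_ε, s) = L(E/K, s)` by genus
  theory; the identification of the `χ_ε`-isotypic `f̃`-datum on `X_U` with `P` — the twisting
  principle — is neither used nor proved here). The (M) value side therefore stays in `E`-currency
  (Liu–Zhang–Zhang 2018 Thm. 3.10 / the BDP construction read at level `p² ∣ N`, the barrier's
  evasion (iii): "their assembly into a value-at-𝟙 theorem in one normalisation at a reducible
  `p ‖ N` is nowhere printed").
* §4 **What the socket's datum DOES hand to the partner**: the door's Heegner field `K`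
  (`SatisfiesHeegnerHypothesis N_E K`) is a Heegner field for `N_V` and `p` splits in `K`
  (`satisfiesHeegnerHypothesis_partner`, `partner_datum_of_subM`) — the datum shape of Keller–Yin's
  multiplicative setting (Thm. D: `p ‖ N`, `p` split, Heegner hypothesis, Eisenstein `p`), so a future
  «imc pot. mult» record for (M) in `(f̃, χ_ε)`-currency needs no new hypothesis on `K`.

References: Cai–Shu–Tian, Algebra Number Theory 8 (2014) §1 condition (1) p. 2524 and Thm. 1.5;
Silverman ATAEC V.5.3 (twist models); the barrier entry's located lists (A)/(B)/(C);
Keller–Yin arXiv:2402.12781 Thm. D (preprint); Liu–Zhang–Zhang, Duke 167 (2018) Thm. 3.10.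
-/

noncomputable section

open scoped Classical

open WeierstrassCurve NumberField IsDedekindDomain IsDedekindDomain.HeightOneSpectrum Field
  Literature.NumberTheory.EllipticCurves
  Literature.NumberTheory.EllipticCurves.CaiShuTian2014
  Literature.NumberTheory.EllipticCurves.ModularForms
  Literature.NumberTheory.EllipticCurves.Rank1Residual
  Summit.BirchSwinnertonDyer.Rank1Residual

-- D-0017 layout: summit = sub-problem, so `Summit.BirchSwinnertonDyer.BirchSwinnertonDyer.…` is the
-- mandated namespace (same option as the route's sockets files).
set_option linter.dupNamespace false
set_option autoImplicit false

namespace Summit.BirchSwinnertonDyer.BirchSwinnertonDyer.Theorems.SchneiderFree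

/-! ## §1 Every `p*`-partner of an (M)-cell pair is a class-X2 pair -/

/-- **Every `p*`-partner of an (M)-cell pair is a class-X2 pair.** For `W/ℚ` globally minimal with
`ClassX3 W p` (reducible `E[p]`, additive `p`), `Additive.SubM W p` (potentially multiplicative) and
`p` odd, and ANY Weierstrass model `V/ℚ` with `C • V^{(p*)} = W`: `ClassX2 V p`, i.e. `p ≠ 2`,
`V[p]` reducible (twist invariance of reducibility) and `V` multiplicative at `p` (the additive
cell's `ClassX3M.mult_of_twist_model_pStar`). [cite: SilvermanATAEC1994, V.5.3 (potentially multiplicative = twist of multiplicative)] -/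
theorem classX2_partner_of_subM {p : ℕ} [Fact p.Prime] (hp2 : p ≠ 2)
    (W : WeierstrassCurve ℚ) [W.IsElliptic] [W.IsGloballyMinimal] (hX : ClassX3 W p)
    (hM : Additive.SubM W p) (V : WeierstrassCurve ℚ) [V.IsElliptic] (C : VariableChange ℚ)
    (hC : C • V.quadraticTwist ((-1 : ℚ) ^ (p / 2) * p) = W) : ClassX2 V p := by
  have hX3M : AdditivePotMult.ClassX3M W p := ⟨hX, ⟨hX.2, hM⟩, hp2⟩
  have hmult : Mult V p := hX3M.mult_of_twist_model_pStar V C hC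
  obtain ⟨C', hC'⟩ :=
    exists_smul_quadraticTwist_eq_of_smul_quadraticTwist_eq V W (Additive.pStar_ne_zero p) C hC
  exact AdditivePotMult.classX2_twist_of_classX3M hX3M (Additive.pStar_ne_zero p) ⟨C', hC'⟩ hmult

/-- **A class-X2 partner EXISTS on the (M) cell**: the globally minimal model `V` of `E^{(p*)}` is
multiplicative at `p`, has `C • V^{(p*)} = W`, and is a class-X2 pair. [cite: SilvermanATAEC1994, V.5.3] -/
theorem exists_classX2_partner_of_subM {p : ℕ} [Fact p.Prime] (hp2 : p ≠ 2)
    (W : WeierstrassCurve ℚ) [W.IsElliptic] [W.IsGloballyMinimal] (hX : ClassX3 W p)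
    (hM : Additive.SubM W p) :
    ∃ (V : WeierstrassCurve ℚ) (_ : V.IsElliptic) (_ : V.IsGloballyMinimal) (C : VariableChange ℚ),
      C • V.quadraticTwist ((-1 : ℚ) ^ (p / 2) * p) = W ∧ ClassX2 V p := by
  have hPM : AdditivePotMult.PotMult W p := ⟨hX.2, hM⟩
  obtain ⟨V, iV, iVm, C, -, hC⟩ := hPM.exists_mult_pStar_twist_model hp2
  exact ⟨V, iV, iVm, C, hC, classX2_partner_of_subM hp2 W hX hM V C hC⟩

/-! ## §2 Placement: the partner lies behind the catalogued barrier `ReducibleAnticyclotomicAtBadP` -/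

/-- **Placement of crux r2 (D-0021).** On the (M) cell, every `p*`-partner `V` of the door's curve
meets NO printed scope of the technique class «anticyclotomic Iwasawa theory at an Eisenstein
prime» — the catalogued barrier `Literature.Barriers.BirchSwinnertonDyer.ReducibleAnticyclotomicAtBadP`
applied by name (`classX2_not_printedScope`): neither the good-reduction scope (CGLS 2022, CGS 2025,
Castella–Hsieh 2018, BDP 2013, Keller–Yin) nor the irreducible scope (Castella 2018, Skinner 2016,
Skinner–Zhang, Disegni 2020) contains `(V, p)`. So every Keller–Yin / Castella–Hsieh-currency input
of crux r2 (H1–H3 rebased on `f̃ = f_V`) is evaluated at an X2 pair, on the ramified `χ_ε`-branch.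
[cite: CastellaGrossiLeeSkinner2022, §3.2 (standing setting p ∤ 2N)] [cite: Castella2018, §2.1 (ρ̄ irreducible)] -/
theorem not_printedScope_partner_of_subM {p : ℕ} [Fact p.Prime] (hp2 : p ≠ 2)
    (W : WeierstrassCurve ℚ) [W.IsElliptic] [W.IsGloballyMinimal] (hX : ClassX3 W p)
    (hM : Additive.SubM W p) (V : WeierstrassCurve ℚ) [V.IsElliptic] (C : VariableChange ℚ)
    (hC : C • V.quadraticTwist ((-1 : ℚ) ^ (p / 2) * p) = W) :
    ¬ Literature.Barriers.BirchSwinnertonDyer.PrintedEisensteinAnticyclotomicScope V p :=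
  Literature.Barriers.BirchSwinnertonDyer.classX2_not_printedScope V p
    (classX2_partner_of_subM hp2 W hX hM V C hC)

/-- **Cell form of the placement** (the crux's own binders): on the whole (M) cell of the door
(`r_an = 1`, `p ≠ 2`, `ClassX3`, `SubM`) there is a globally minimal `p*`-partner `V`,
`C • V^{(p*)} = W`, and EVERY such partner is a class-X2 pair outside every printed scope of the
barrier's technique class. [cite: CastellaGrossiLeeSkinner2022, §3.2] [cite: Castella2018, §2.1] -/
theorem potMultCell_partner_behind_barrier :
    ∀ (W : WeierstrassCurve ℚ) [W.IsElliptic] [W.IsGloballyMinimal] (p : ℕ) [Fact p.Prime],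
      W.analyticRank = 1 → p ≠ 2 → ClassX3 W p → Additive.SubM W p →
        (∃ (V : WeierstrassCurve ℚ) (_ : V.IsElliptic) (_ : V.IsGloballyMinimal)
            (C : VariableChange ℚ), C • V.quadraticTwist ((-1 : ℚ) ^ (p / 2) * p) = W) ∧
          ∀ (V : WeierstrassCurve ℚ) [V.IsElliptic] (C : VariableChange ℚ),
            C • V.quadraticTwist ((-1 : ℚ) ^ (p / 2) * p) = W →
              ClassX2 V p ∧
                ¬ Literature.Barriers.BirchSwinnertonDyer.PrintedEisensteinAnticyclotomicScope V p := by
  intro W _ _ p _ _ hp2 hX hM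
  refine ⟨?_, fun V _ C hC ↦ ⟨classX2_partner_of_subM hp2 W hX hM V C hC,
    not_printedScope_partner_of_subM hp2 W hX hM V C hC⟩⟩
  obtain ⟨V, iV, iVm, C, hC, -⟩ := exists_classX2_partner_of_subM hp2 W hX hM
  exact ⟨V, iV, iVm, C, hC⟩

/-! ## §3 Obstruction: Cai–Shu–Tian's Heegner condition (1) fails for the partner at conductor `p` -/

/-- **Cai–Shu–Tian's Heegner condition (1)–(2) at conductor `c = p` FAILS for a curve multiplicative
at `p`**: its first clause is `(c, N) = 1` (ANT 8 (2014) p. 2524, condition (1); tree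
`HeegnerConditionRC.coprime`), while `p ∣ N_V` at a multiplicative prime
(`AdditivePotMult.dvd_conductorNorm_of_mult`). Holds for every field `K`, newform slot `ϕ` and
character `χ`. [cite: CaiShuTian2014, §1 Heegner condition (1) (p. 2524)] [cite: Silverman1994, IV.10.2(a) (p ∣ N at bad reduction)] -/
theorem not_heegnerConditionRC_of_mult (V : WeierstrassCurve ℚ) [V.IsElliptic] {p : ℕ}
    [Fact p.Prime] (hmult : Mult V p) (K : Type) [Field K] [NumberField K] {N : ℕ}
    (ϕ : CuspForm (CongruenceSubgroup.Gamma0 N) 2)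
    (χgal : Field.absoluteGaloisGroup K →ₜ* ℂˣ) : ¬ HeegnerConditionRC V K p ϕ χgal := by
  intro h
  have hdvd : p ∣ V.conductorNorm ℤ := AdditivePotMult.dvd_conductorNorm_of_mult V hmult
  exact (Fact.out : p.Prime).ne_one (Nat.Coprime.eq_one_of_dvd h.coprime hdvd)

/-- **The rebased value road does not instantiate on (M).** For every `p*`-partner `V` of an
(M)-cell pair (`C • V^{(p*)} = W`, `W` globally minimal, `ClassX3 W p`, `SubM W p`, `p` odd) and
every `K`, `ϕ`, `χ`: `¬ HeegnerConditionRC V K p ϕ χ` — the binder `hHC` of door-c3's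
`additiveIMCLowerBDPOnTreeLeAt_of_valueAt_twisted_of_genusDatum'` (Cai–Shu–Tian Thm. 1.1 for the
partner's conductor-`p` twisted Heegner point) is unsatisfiable when the partner is the (M) cell's.
The printed replacement at joint ramification is Cai–Shu–Tian's general Thm. 1.5 (untyped); on (M)
the door's own conductor-1 datum `P ∈ E(K)` with `gross_zagier` is the natural value-side input
(no rebase).
[cite: CaiShuTian2014, §1 Heegner condition (1) (p. 2524) and Thm. 1.5] -/
theorem not_heegnerConditionRC_partner_of_subM {p : ℕ} [Fact p.Prime] (hp2 : p ≠ 2)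
    (W : WeierstrassCurve ℚ) [W.IsElliptic] [W.IsGloballyMinimal] (hX : ClassX3 W p)
    (hM : Additive.SubM W p) (V : WeierstrassCurve ℚ) [V.IsElliptic] (C : VariableChange ℚ)
    (hC : C • V.quadraticTwist ((-1 : ℚ) ^ (p / 2) * p) = W)
    (K : Type) [Field K] [NumberField K] {N : ℕ} (ϕ : CuspForm (CongruenceSubgroup.Gamma0 N) 2)
    (χgal : Field.absoluteGaloisGroup K →ₜ* ℂˣ) : ¬ HeegnerConditionRC V K p ϕ χgal :=
  not_heegnerConditionRC_of_mult V (classX2_partner_of_subM hp2 W hX hM V C hC).2.2 K ϕ χgal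

/-- **By contrast, on the (G-ord, `e = 2`) cell the clause holds trivially at `p`**: a partner with
GOOD reduction at `p` has `p ∤ N_{W′}` (tree `dvd_conductorNorm_iff_not_hasGoodReductionAtPrime`), so
`(p, N_{W′}) = 1` — the asymmetry between the two branch cruxes is exactly the reduction type of the
partner at `p`. [cite: DiamondShurman2005, §8.3 (p ∣ N_E iff bad reduction)] -/
theorem coprime_conductorNorm_of_good (V : WeierstrassCurve ℚ) [V.IsElliptic] {p : ℕ}
    [Fact p.Prime] (hgood : Good V p) : Nat.Coprime p (V.conductorNorm ℤ) := by
  have hndvd : ¬ p ∣ V.conductorNorm ℤ := fun h ↦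
    ((V.dvd_conductorNorm_iff_not_hasGoodReductionAtPrime p).mp h) hgood
  exact (Nat.Prime.coprime_iff_not_dvd (Fact.out : p.Prime)).mpr hndvd

/-! ## §4 What the door's own datum DOES supply to the partner: the Heegner field and the split prime -/

/-- **The bad primes of the partner divide the door's level.** For `C • V^{(p*)} = W` over `ℚ`
(`p` odd) with `W` bad at `p`: every prime `ℓ ∣ N_V` divides `N_W` — at `ℓ ≠ p` the conductor
exponents of `V` and `W` agree (the `p*`-twist is unramified away from `p`, tree
`Additive.conductorExponent_eq_of_twist_pStar_of_ne`) and `N = ∏ ℓ^{f_ℓ}`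
(`factorization_conductorNorm_holds`); at `ℓ = p`, `p ∣ N_W` because `W` is bad at `p`.
[cite: SilvermanATAEC1994, IV.9.4 and IV.10.2(a)] -/
theorem dvd_conductorNorm_of_dvd_conductorNorm_partner {p : ℕ} [Fact p.Prime] (hp2 : p ≠ 2)
    (W : WeierstrassCurve ℚ) [W.IsElliptic] (hbad : ¬ W.HasGoodReductionAtPrime p)
    (V : WeierstrassCurve ℚ) [V.IsElliptic] (C : VariableChange ℚ)
    (hC : C • V.quadraticTwist ((-1 : ℚ) ^ (p / 2) * p) = W) {ℓ : ℕ} (hℓ : ℓ.Prime)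
    (hdvd : ℓ ∣ V.conductorNorm ℤ) : ℓ ∣ W.conductorNorm ℤ := by
  by_cases hℓp : ℓ = p
  · rw [hℓp]
    exact (W.dvd_conductorNorm_iff_not_hasGoodReductionAtPrime p).mpr hbad
  · haveI : Fact ℓ.Prime := ⟨hℓ⟩
    have hgen : Rat.HeightOneSpectrum.natGenerator (Additive.placeOf ℓ) = ℓ :=
      Additive.natGenerator_placeOf_eq ℓ
    have hW' := W.factorization_conductorNorm_holds (Additive.placeOf ℓ)
    have hV' := V.factorization_conductorNorm_holds (Additive.placeOf ℓ)
    rw [hgen] at hW' hV'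
    have hf : W.conductorExponent (Additive.placeOf ℓ) = V.conductorExponent (Additive.placeOf ℓ) :=
      Additive.conductorExponent_eq_of_twist_pStar_of_ne p hp2 V W C hC (Additive.placeOf ℓ)
        (by rw [hgen]; exact hℓp)
    rw [hℓ.dvd_iff_one_le_factorization (V.conductorNorm_pos_holds).ne', hV'] at hdvd
    rw [hℓ.dvd_iff_one_le_factorization (W.conductorNorm_pos_holds).ne', hW', hf]
    exact hdvd

/-- **The door's Heegner field is a Heegner field for the partner.** If every prime factor of
`N_W` splits in `K` (the socket's `SatisfiesHeegnerHypothesis N_W K`) and `W` is bad at the odd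
prime `p`, then every prime factor of `N_V` splits in `K`, for every `p*`-partner `V`
(`C • V^{(p*)} = W`). [cite: GrossLMS1991, §1 (p. 235) (Heegner hypothesis)] -/
theorem satisfiesHeegnerHypothesis_partner {p : ℕ} [Fact p.Prime] (hp2 : p ≠ 2)
    (W : WeierstrassCurve ℚ) [W.IsElliptic] (hbad : ¬ W.HasGoodReductionAtPrime p)
    (V : WeierstrassCurve ℚ) [V.IsElliptic] (C : VariableChange ℚ)
    (hC : C • V.quadraticTwist ((-1 : ℚ) ^ (p / 2) * p) = W) (K : Type) [Field K]
    (hHe : SatisfiesHeegnerHypothesis (W.conductorNorm ℤ) K) :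
    SatisfiesHeegnerHypothesis (V.conductorNorm ℤ) K :=
  fun ℓ hℓ hℓV ↦ hHe ℓ hℓ (dvd_conductorNorm_of_dvd_conductorNorm_partner hp2 W hbad V C hC hℓ hℓV)

/-- **On the (M) cell the socket's datum transfers to the partner**: for every Heegner field `K` of
the door's curve (`SatisfiesHeegnerHypothesis N_W K`) and every `p*`-partner `V`: `K` is a Heegner
field for `N_V`, `p` SPLITS in `K` (it divides `N_W`, `W` being additive at `p`), and `V` is a
class-X2 pair — i.e. `(f_V, K, p)` is exactly the datum shape of Keller–Yin's multiplicative
anticyclotomic setting (arXiv:2402.12781 Thm. D: `p ‖ N`, `p` split in `K`, Heegner hypothesis,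
Eisenstein `p`), read on the `χ_ε`-branch. Nothing of Keller–Yin is asserted. [cite: GrossLMS1991, §1 (p. 235)]
[cite: KellerYin2024, Theorem D = Thm. 5.1.3 (datum shape only; preprint)] -/
theorem partner_datum_of_subM {p : ℕ} [Fact p.Prime] (hp2 : p ≠ 2)
    (W : WeierstrassCurve ℚ) [W.IsElliptic] [W.IsGloballyMinimal] (hX : ClassX3 W p)
    (hM : Additive.SubM W p) (V : WeierstrassCurve ℚ) [V.IsElliptic] (C : VariableChange ℚ)
    (hC : C • V.quadraticTwist ((-1 : ℚ) ^ (p / 2) * p) = W) (K : Type) [Field K]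
    (hHe : SatisfiesHeegnerHypothesis (W.conductorNorm ℤ) K) :
    SatisfiesHeegnerHypothesis (V.conductorNorm ℤ) K ∧
      ((Ideal.span {(p : ℤ)}).primesOver (𝓞 K)).ncard = 2 ∧ ClassX2 V p :=
  ⟨satisfiesHeegnerHypothesis_partner hp2 W hX.2.1 V C hC K hHe,
    hHe p (Fact.out : p.Prime) ((W.dvd_conductorNorm_iff_not_hasGoodReductionAtPrime p).mpr hX.2.1),
    classX2_partner_of_subM hp2 W hX hM V C hC⟩

end Summit.BirchSwinnertonDyer.BirchSwinnertonDyer.Theorems.SchneiderFree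

end
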